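import Summits.CriticalPhenomena.PercolationContinuityZ3.Theorems.PercNearOneGluingNoHeavyLowerTailSahiCombTriWPairLocal

/-!
# `TRI_W(a) ≥ 0` for EVERY index cube when the fibre cube has dimension three, I: the certificates for all 20 up-sets of `2^3`, the 8-point model, and the lower half of the check

Support file of the one-cut programme (crux `NoHeavyLowerTail`, stmt-CriticalPhenomena-4575; cell `prim-masterthm`, seat P5 gen 23;
memo `FROM-prim-masterthm-p5-g23-PAIR-LOCAL.md`).  Target of the lane: `FiveUpSet.TriWIneq` (`…SahiCombTriWGeneral`, OPEN for `a ≥ 2` in general).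

By the PAIR-LOCAL PRINCIPLE (`…SahiCombTriWPairLocal`: `triW_nonneg_of_pairLocalCert`) it suffices, for the fibre cube `W = Finset (Fin 3)` and a test
up-set `P ⊆ W`, to exhibit `c > 0` and a weight `κ_P : W → W → ℕ` with the ONE-CUBE inequality
`Σ_{u,e} κ_P(u,e)·([u∈F]−[u∈F'])·([e∈G]−[e∈G']) ≤ c · triWOne P F F' G G'` for all up-sets `F, F', G, G'` of `W` (`PairLocalCert P c κ_P`).
The weights below were found by an exact LP with row generation over all `20⁴ = 160000` quadruples of up-sets (kit j163969, code23/loc4) and verified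
there in integer arithmetic; here they are re-checked inside Lean by ONE evaluation of a closed Boolean term (`native_decide`), after transporting
the whole statement to the 8-point model `Fin 8` of the cube `Finset (Fin 3)` (point `s ↦ Σ_{i∈s} 2^i`, complement `↦ Fin.rev`) where finset
arithmetic is cheap.  Shape of the certificates: `c = 4`, total weight `Σ κ_P = 4·#P` (forced by the rows `(W,∅,W,∅)`, `(∅,W,W,∅)`), supported on `P × P`;
e.g. `P = W \ {∅}`: `κ/2 = δ_(1,1)+δ_(3,3)+δ_(4,5)+δ_(5,4)+δ_(6,6)+2δ_(7,7)` (points as 3-bit masks).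

* transport to `Fin 8`: `FiveUpSet.ptMask`, `pt8` (an equivalence `Finset (Fin 3) ≃ Fin 8` intertwining `compl` and `Fin.rev`), `triWOne_map` (the
  thin-edge functional is invariant under equivariant embeddings — lattice-general), `sgnDiff_map`;
* `FiveUpSet.kapList3` / `listMult` / `kap3Tab` / `kap3` — the weight table (sparse lists; `sum_sum_listMult`); `FiveUpSet.ups3F`, `ups8`, `row8` — the check rows;
* `FiveUpSet.plc8_lo` — the rows of the 10 test up-sets with family mask `≤ 224` (computational, `native_decide`; ≈ 5 min).
The upper half of the check, `PairLocalCert P 4 (kap3 P)` for every up-set `P` and the theorem `triW_nonneg_fin_three` (TriWIneq on every cell `(a,3)`)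
are in the companion `…SahiCombTriWFibreThree` (split only to bound elaboration time).
HONEST LABEL: the reduction is proved in `…TriWPairLocal` (std axioms); the certificate check here is COMPUTATIONAL (`native_decide`, axiom
`Lean.ofReduceBool`); `TriWIneq` for `n ≥ 4` stays OPEN (pair-local certificates with point-gap weights exist for 23 of the 24 classes of up-sets of
`2^4` — kit j163638, exact on all `168⁴` rows — and do NOT exist for `P = K₂₂ = (x₀∨x₁)(x₂∨x₃)`, kit j163935). [this work]
-/

namespace Summit.CriticalPhenomena.PercolationContinuityZ3.Theorems

open Finset

/-! ### Lattice-general transport of the thin-edge functional along an equivariant embedding -/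

namespace LatticeFiveUpSet

variable {W W' : Type*} [DecidableEq W] [DecidableEq W']

/-- `map` commutes with the antipode images when the embedding intertwines the antipodes. [this work] -/
theorem map_image_of_semiconj (τ : W ≃ W) (τ' : W' ≃ W') (φ : W ↪ W') (hφ : ∀ w, φ (τ w) = τ' (φ w)) (A : Finset W) :
    (A.map φ).image τ' = (A.image τ).map φ := by
  ext x
  simp only [mem_image, mem_map]
  constructor
  · rintro ⟨y, ⟨w, hw, rfl⟩, rfl⟩
    exact ⟨τ w, ⟨w, hw, rfl⟩, hφ w⟩
  · rintro ⟨y, ⟨w, hw, rfl⟩, rfl⟩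
    exact ⟨φ w, ⟨w, hw, rfl⟩, (hφ w).symm⟩

/-- **Transport of `triWOne`** along an embedding `φ : W ↪ W'` with `φ ∘ τ = τ' ∘ φ`. [this work] -/
theorem triWOne_map (τ : W ≃ W) (τ' : W' ≃ W') (φ : W ↪ W') (hφ : ∀ w, φ (τ w) = τ' (φ w)) (P F₀ F₁ G₀ G₁ : Finset W) :
    triWOne τ' (P.map φ) (F₀.map φ) (F₁.map φ) (G₀.map φ) (G₁.map φ) = triWOne τ P F₀ F₁ G₀ G₁ := by
  unfold triWOne
  simp only [map_image_of_semiconj τ τ' φ hφ, ← map_inter, card_map]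

end LatticeFiveUpSet

namespace FiveUpSet

/-! ### The 8-point model of the cube `Finset (Fin 3)` -/

/-- Bitmask of a point of the cube `Finset (Fin 3)` (bit `i` for element `i`). [this work] -/
def ptMask (s : Finset (Fin 3)) : ℕ := ∑ i ∈ s, 2 ^ (i : ℕ)

/-- `ptMask s < 8`. [this work] -/
theorem ptMask_lt : ∀ s : Finset (Fin 3), ptMask s < 8 := by decide

/-- The inverse: the set of bits of `i < 8`. [this work] -/
def ptOfFin (i : Fin 8) : Finset (Fin 3) := univ.filter fun k => Nat.testBit (i : ℕ) (k : ℕ)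

/-- The point model as an equivalence `Finset (Fin 3) ≃ Fin 8`. [this work] -/
def pt8 : Finset (Fin 3) ≃ Fin 8 where
  toFun s := ⟨ptMask s, ptMask_lt s⟩
  invFun := ptOfFin
  left_inv := by decide
  right_inv := by decide

/-- The point model intertwines complementation and `Fin.rev` (`7 − ·`). [this work] -/
theorem pt8_compl : ∀ s : Finset (Fin 3), pt8.toEmbedding (complEquiv (Fin 3) s) = Fin.revPerm (pt8.toEmbedding s) := by decide

/-- The signed indicator difference on families of `Fin 8`. [this work] -/
def sgnDiff8 (A A' : Finset (Fin 8)) (i : Fin 8) : ℤ := (if i ∈ A then 1 else 0) - (if i ∈ A' then 1 else 0)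

/-- Transport of `sgnDiff`. [this work] -/
theorem sgnDiff_map (F F' : Finset (Finset (Fin 3))) (u : Finset (Fin 3)) :
    sgnDiff F F' u = sgnDiff8 (F.map pt8.toEmbedding) (F'.map pt8.toEmbedding) (pt8 u) := by
  unfold sgnDiff sgnDiff8
  simp only [Finset.mem_map_equiv, Equiv.symm_apply_apply]

/-- Bitmask of a family of `Fin 8` (bit `i` for member `i`); on images of families of `Finset (Fin 3)` this is the family mask. [this work] -/
def m8 (S : Finset (Fin 8)) : ℕ := ∑ i ∈ S, 2 ^ (i : ℕ)

/-! ### The certificate table (LP output, kit j163969; multiplier `c = 4`) -/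

/-- The certificate weights as sparse lists `family mask of P ↦ [(u, e, κ_P(u,e))]` (points of the 8-point model; LP output, kit j163969;
multiplier `c = 4`). [this work] -/
def kapList3 : ℕ → List (Fin 8 × Fin 8 × ℕ)
  | 0 => []
  | 128 => [(7, 7, 4)]
  | 136 => [(3, 3, 4), (7, 7, 4)]
  | 160 => [(5, 5, 4), (7, 7, 4)]
  | 168 => [(5, 5, 4), (7, 7, 8)]
  | 170 => [(1, 5, 4), (3, 7, 4), (5, 1, 4), (7, 3, 4)]
  | 192 => [(6, 6, 4), (7, 7, 4)]
  | 200 => [(6, 6, 4), (7, 7, 8)]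
  | 204 => [(2, 6, 4), (3, 7, 4), (6, 3, 4), (7, 2, 4)]
  | 224 => [(6, 6, 4), (7, 7, 8)]
  | 232 => [(3, 6, 4), (5, 5, 4), (6, 7, 4), (7, 7, 4)]
  | 234 => [(1, 5, 4), (3, 7, 4), (5, 7, 4), (7, 1, 4), (7, 3, 4)]
  | 236 => [(3, 5, 4), (3, 7, 4), (5, 3, 4), (6, 6, 4), (7, 3, 4)]
  | 238 => [(1, 6, 4), (3, 5, 4), (3, 7, 4), (5, 1, 4), (7, 3, 8)]
  | 240 => [(4, 7, 4), (5, 4, 4), (6, 5, 4), (7, 6, 4)]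
  | 248 => [(4, 5, 2), (5, 4, 2), (5, 7, 2), (6, 3, 2), (6, 7, 4), (7, 5, 2), (7, 6, 6)]
  | 250 => [(3, 6, 4), (4, 4, 4), (5, 5, 8), (6, 7, 4), (7, 7, 4)]
  | 252 => [(3, 7, 4), (4, 6, 4), (5, 3, 4), (6, 4, 4), (6, 7, 4), (7, 6, 4)]
  | 254 => [(1, 1, 4), (3, 3, 4), (4, 5, 4), (5, 4, 4), (6, 6, 4), (7, 7, 8)]
  | 255 => [(0, 3, 4), (1, 2, 4), (2, 1, 4), (3, 0, 4), (4, 4, 4), (5, 5, 4), (6, 7, 4), (7, 6, 4)]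
  | _ => []

/-- Multiplicity of the pair `(i, j)` in a weight list. [this work] -/
def listMult (l : List (Fin 8 × Fin 8 × ℕ)) (i j : Fin 8) : ℕ :=
  l.foldr (fun t acc => (if t.1 = i ∧ t.2.1 = j then t.2.2 else 0) + acc) 0

/-- A double sum against the multiplicity function of a weight list is the list sum. [this work] -/
theorem sum_sum_listMult (l : List (Fin 8 × Fin 8 × ℕ)) (x y : Fin 8 → ℤ) :
    ∑ i : Fin 8, ∑ j : Fin 8, (listMult l i j : ℤ) * x i * y j = (l.map fun t => (t.2.2 : ℤ) * x t.1 * y t.2.1).sum := by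
  induction l with
  | nil => simp [listMult]
  | cons t l ih =>
    have hstep : ∀ i j : Fin 8, (listMult (t :: l) i j : ℤ) = (if t.1 = i ∧ t.2.1 = j then (t.2.2 : ℤ) else 0) + (listMult l i j : ℤ) := by
      intro i j
      simp only [listMult, List.foldr_cons]
      push_cast
      split <;> simp
    simp only [hstep, add_mul, sum_add_distrib, ih, List.map_cons, List.sum_cons]
    congr 1
    rw [Finset.sum_eq_single t.1, Finset.sum_eq_single t.2.1]
    · simp
    · intro j _ hj; simp [Ne.symm hj]
    · simp
    · intro i _ hi; apply Finset.sum_eq_zero; intro j _; simp [Ne.symm hi]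
    · simp

/-- The certificate weight table `(family mask of P, point i, point j) ↦ κ`. [this work] -/
def kap3Tab (m : ℕ) (i j : Fin 8) : ℕ := listMult (kapList3 m) i j

/-- The certificate weight `κ_P(u,e)` for a test family `P` and points `u, e` of `Finset (Fin 3)`. [this work] -/
def kap3 (P : Finset (Finset (Fin 3))) (u e : Finset (Fin 3)) : ℕ :=
  kap3Tab (m8 (P.map pt8.toEmbedding)) (pt8 u) (pt8 e)

/-! ### The finite check in the 8-point model -/

/-- Boolean up-set test on families of subsets of `Fin 3`: closed under inserting one element. [this work] -/
def isUpB (F : Finset (Finset (Fin 3))) : Bool :=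
  decide (∀ s ∈ F, ∀ i : Fin 3, insert i s ∈ F)

/-- An up-set passes the Boolean test. [this work] -/
theorem isUpB_of_isUpperSet {F : Finset (Finset (Fin 3))} (h : IsUpperSet (F : Set (Finset (Fin 3)))) : isUpB F = true := by
  unfold isUpB
  rw [decide_eq_true_eq]
  intro s hs i
  exact Finset.mem_coe.1 (h (Finset.subset_insert i s) (Finset.mem_coe.2 hs))

/-- The up-sets of `Finset (Fin 3)` (the 20 families passing `isUpB`). [this work] -/
def ups3F : Finset (Finset (Finset (Fin 3))) := univ.filter fun F => isUpB F = true

/-- Their images in the 8-point model. [this work] -/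
def ups8 : Finset (Finset (Fin 8)) := ups3F.image fun F => F.map pt8.toEmbedding

/-- An up-set's image belongs to `ups8`. [this work] -/
theorem map_mem_ups8 {F : Finset (Finset (Fin 3))} (h : IsUpperSet (F : Set (Finset (Fin 3)))) : F.map pt8.toEmbedding ∈ ups8 := by
  unfold ups8 ups3F
  exact mem_image_of_mem _ (mem_filter.2 ⟨mem_univ _, isUpB_of_isUpperSet h⟩)

/-- One row of the certificate inequality in the 8-point model, as a Boolean. [this work] -/
def row8 (Q A A' B B' : Finset (Fin 8)) : Bool :=
  decide (((kapList3 (m8 Q)).map fun t => (t.2.2 : ℤ) * sgnDiff8 A A' t.1 * sgnDiff8 B B' t.2.1).sum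
            ≤ ((4 : ℕ) : ℤ) * LatticeFiveUpSet.triWOne Fin.revPerm Q A A' B B')

/-- **The finite check, lower half** (computational, `native_decide`): every certificate row for the 10 test up-sets with family mask `≤ 224`
(`10 × 20⁴ = 1.6·10⁶` rows). [this work] -/
theorem plc8_lo : ∀ Q ∈ ups8.filter (fun Q => m8 Q ≤ 224), ∀ A ∈ ups8, ∀ A' ∈ ups8, ∀ B ∈ ups8, ∀ B' ∈ ups8,
    row8 Q A A' B B' = true := by
  native_decide

end FiveUpSet

end Summit.CriticalPhenomena.PercolationContinuityZ3.Theorems
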